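import Summits.Schanuel.Schanuel.Theorems.ZilberEacRationalAsymptote
import Summits.Schanuel.Schanuel.Theorems.ZilberEacRationalGraphFibres
import Summits.Schanuel.Schanuel.Theorems.ZilberEacPlaneCurvePolyFibres
import HarnessLib

/-!
# Arbitrary base branches, LXXXVII (a): curves of `x₁`-degree ONE that are not lines — no line
# inside, on no line, Mantova–Masser's case

HONEST FRAMING.  Cell `pub-schanuel` (Zilber's Exponential-Algebraic Closedness, case ladder;
host summit Schanuel), seat 2, gen 32.  Files LXIV / LXVIII(b) / LXXXIII assume `x₁`-degree
`n ≥ 2` only to know that the irreducible curve `C : F = 0` neither contains nor lies on a line.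
This file replaces `n ≥ 2` by the sharp syntactic condition
**`n ≥ 1`, and if `n = 1` then the leading row `a(x₀)` is non-constant or the constant row has
degree `≥ 2`** — i.e. `C` is an honest curve (`x₁`-degree `≥ 2`), an unbounded or bounded
rational graph `x₁ = -b(x₀)/a(x₀)` with `deg a ≥ 1`, or a polynomial graph of degree `≥ 2`; the
only irreducible `F` of positive `x₁`-degree excluded are the LINES `c·x₁ + (αx₀ + β)`:
`planeCurve_not_contains_line_of_notLine`, `planeCurve_exists_offLine_of_notLine`,
`mmCase_planeCurve_polyFibre_of_notLine`.  Bookkeeping toward "every curve over `ℚ̄`" including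
`x₁`-degree `1` (file LXXXVII(b) transports rational asymptotes without the degree hypothesis).
Mantova–Masser's question (PLMS 2024 §1 p. 5) OPEN in general; EC(3,2) OPEN; NOT Schanuel's
conjecture (neither used nor implied); EAC ⇏ SC.
-/

noncomputable section

open Filter Topology Set Complex Polynomial
open Literature.NumberTheory.Transcendental Literature.ModelTheory.Zilber
open Literature.ModelTheory.ExponentialFields

set_option linter.dupNamespace false

namespace Summit.Schanuel.Schanuel.Theorems

section NotLine

variable (F : ℂ[X][X])

/-- A degree-one `F = a(x₀)x₁ + b(x₀)` with `b = a·L`, `deg L ≤ 1`, and `deg a ≥ 1` or `deg b ≥ 2`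
is reducible. [folklore] -/
theorem not_irreducible_of_coeff_zero_eq_mul (h1 : F.natDegree = 1) (L : ℂ[X])
    (hL : L.natDegree ≤ 1) (hβ : F.coeff 0 = F.coeff 1 * L)
    (hnl : 1 ≤ (F.coeff 1).natDegree ∨ 2 ≤ (F.coeff 0).natDegree) : ¬ Irreducible F := by
  intro hFirr
  by_cases hα : 1 ≤ (F.coeff 1).natDegree
  · have hF : F = Polynomial.C (F.coeff 1) * (X + Polynomial.C L) := by
      conv_lhs => rw [Polynomial.eq_X_add_C_of_natDegree_le_one (le_of_eq h1)]
      rw [hβ, Polynomial.C_mul]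
      ring
    rcases hFirr.isUnit_or_isUnit hF with hu | hu
    · rw [Polynomial.isUnit_C] at hu
      have := Polynomial.natDegree_eq_zero_of_isUnit hu
      omega
    · have h2 := Polynomial.natDegree_eq_zero_of_isUnit hu
      rw [Polynomial.natDegree_X_add_C] at h2
      exact one_ne_zero h2
  · have h2 : (F.coeff 0).natDegree ≤ (F.coeff 1).natDegree + L.natDegree := by
      rw [hβ]
      exact Polynomial.natDegree_mul_le
    rcases hnl with h | h <;> omega

/-- Evaluation of a degree-one `F`. [folklore] -/
theorem eval_of_natDegree_eq_one (h1 : F.natDegree = 1) (x y : ℂ) :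
    (F.map (Polynomial.evalRingHom x)).eval y = (F.coeff 1).eval x * y + (F.coeff 0).eval x := by
  nth_rw 1 [Polynomial.eq_X_add_C_of_natDegree_le_one (le_of_eq h1)]
  exact eval_rationalGraph _ _ x y

/-- **No line inside.**  `F` irreducible of `x₁`-degree `n ≥ 1`, and if `n = 1` then `deg a ≥ 1`
or `deg b ≥ 2`: the curve contains no line `m₀x₀ + m₁x₁ = a` with `m₁ ≠ 0`. [folklore] -/
theorem planeCurve_not_contains_line_of_notLine (hFirr : Irreducible F) (hF1 : 1 ≤ F.natDegree)
    (hnl : F.natDegree = 1 → 1 ≤ F.leadingCoeff.natDegree ∨ 2 ≤ (F.coeff 0).natDegree)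
    (m₀ m₁ a : ℂ) (hm₁ : m₁ ≠ 0) :
    ∃ x₀ : ℂ, (F.map (Polynomial.evalRingHom x₀)).eval ((a - m₀ * x₀) / m₁) ≠ 0 := by
  classical
  by_cases hn : 2 ≤ F.natDegree
  · exact planeCurve_not_contains_line F hFirr hn m₀ m₁ a hm₁
  have h1 : F.natDegree = 1 := by omega
  have hlc : F.leadingCoeff = F.coeff 1 := by rw [Polynomial.leadingCoeff, h1]
  by_contra hall
  push Not at hall
  set L : ℂ[X] := Polynomial.C (m₀ / m₁) * X + Polynomial.C (-(a / m₁)) with hL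
  have hLdeg : L.natDegree ≤ 1 := Polynomial.natDegree_linear_le
  have hβ : F.coeff 0 = F.coeff 1 * L := by
    refine Polynomial.funext fun x => ?_
    have h := hall x
    rw [eval_of_natDegree_eq_one F h1] at h
    rw [Polynomial.eval_mul, hL, Polynomial.eval_add, Polynomial.eval_mul, Polynomial.eval_C,
      Polynomial.eval_X, Polynomial.eval_C]
    field_simp at h
    field_simp
    linear_combination h
  exact not_irreducible_of_coeff_zero_eq_mul F h1 L hLdeg hβ (by rw [← hlc]; exact hnl h1) hFirr

/-- **On no line.**  Under the same hypothesis the curve lies on no line `m·x = c₀`, `m ∈ ℤ² ∖ 0`.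
[folklore] -/
theorem planeCurve_exists_offLine_of_notLine (hFirr : Irreducible F) (hF1 : 1 ≤ F.natDegree)
    (hnl : F.natDegree = 1 → 1 ≤ F.leadingCoeff.natDegree ∨ 2 ≤ (F.coeff 0).natDegree)
    (m : Fin 2 → ℤ) (hm : m ≠ 0) (c₀ : ℂ) :
    ∃ x y : ℂ, (F.map (Polynomial.evalRingHom x)).eval y = 0 ∧
      (m 0 : ℂ) * x + (m 1 : ℂ) * y ≠ c₀ := by
  classical
  by_cases hn : 2 ≤ F.natDegree
  · exact planeCurve_exists_offLine F hFirr hn m hm c₀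
  have h1 : F.natDegree = 1 := by omega
  have hlc : F.leadingCoeff = F.coeff 1 := by rw [Polynomial.leadingCoeff, h1]
  have hFeq : F = Polynomial.C (F.coeff 1) * X + Polynomial.C (F.coeff 0) :=
    Polynomial.eq_X_add_C_of_natDegree_le_one (le_of_eq h1)
  have hα0 : F.coeff 1 ≠ 0 := by
    rw [← hlc]
    exact Polynomial.leadingCoeff_ne_zero.2 hFirr.ne_zero
  by_cases hα : 1 ≤ (F.coeff 1).natDegree
  · have hirr' : Irreducible (Polynomial.C (F.coeff 1) * X + Polynomial.C (F.coeff 0) : ℂ[X][X]) := by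
      rw [← hFeq]; exact hFirr
    obtain ⟨x, y, hxy, hne⟩ := rationalGraph_exists_offLine (F.coeff 1) (F.coeff 0) hirr' hα m hm c₀
    exact ⟨x, y, by rw [hFeq]; exact hxy, hne⟩
  -- polynomial graph `x₁ = -b(x₀)/c`, `deg b ≥ 2`
  have hβ2 : 2 ≤ (F.coeff 0).natDegree := by
    rcases hnl h1 with h | h
    · rw [hlc] at h; omega
    · exact h
  have hαdeg : (F.coeff 1).natDegree = 0 := by omega
  obtain ⟨c, hc⟩ : ∃ c : ℂ, F.coeff 1 = Polynomial.C c := ⟨_, Polynomial.eq_C_of_natDegree_eq_zero hαdeg⟩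
  have hc0 : c ≠ 0 := by rintro rfl; rw [map_zero] at hc; exact hα0 hc
  by_contra hall
  push Not at hall
  have hpt : ∀ x : ℂ, (m 0 : ℂ) * x + (m 1 : ℂ) * (-(F.coeff 0).eval x / c) = c₀ := by
    intro x
    refine hall x _ ?_
    rw [eval_of_natDegree_eq_one F h1, hc, Polynomial.eval_C]
    field_simp
    ring
  have hP : Polynomial.C (m 1 : ℂ) * F.coeff 0 =
      Polynomial.C ((m 0 : ℂ) * c) * X + Polynomial.C (-(c₀ * c)) := by
    refine Polynomial.funext fun x => ?_
    have h := hpt x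
    field_simp at h
    simp only [Polynomial.eval_mul, Polynomial.eval_C, Polynomial.eval_add, Polynomial.eval_X]
    linear_combination -h
  by_cases hm1 : (m 1 : ℂ) = 0
  · have hm0 : (m 0 : ℂ) ≠ 0 := by
      intro h0
      apply hm
      funext i
      fin_cases i
      · exact_mod_cast h0
      · exact_mod_cast hm1
    have h := congrArg (fun p : ℂ[X] => p.coeff 1) hP
    simp only [hm1, map_zero, zero_mul, Polynomial.coeff_zero, Polynomial.coeff_add,
      Polynomial.coeff_C_mul, Polynomial.coeff_X_one, mul_one, Polynomial.coeff_C_succ,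
      add_zero] at h
    exact mul_ne_zero hm0 hc0 h.symm
  · have hdeg : (Polynomial.C (m 1 : ℂ) * F.coeff 0).natDegree = (F.coeff 0).natDegree :=
      Polynomial.natDegree_C_mul hm1
    have hdeg' : (Polynomial.C ((m 0 : ℂ) * c) * X + Polynomial.C (-(c₀ * c)) : ℂ[X]).natDegree ≤ 1 :=
      Polynomial.natDegree_linear_le
    rw [← hP, hdeg] at hdeg'
    omega

/-- **Mantova–Masser's case for polynomial fibres** over such a curve (`R` nonzero somewhere on
it). [folklore] (new) -/
theorem mmCase_planeCurve_polyFibre_of_notLine (hFirr : Irreducible F) (hF1 : 1 ≤ F.natDegree)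
    (hnl : F.natDegree = 1 → 1 ≤ F.leadingCoeff.natDegree ∨ 2 ≤ (F.coeff 0).natDegree)
    (R : MvPolynomial (Fin 2) ℂ)
    (hR : ∃ x y : ℂ, (F.map (Polynomial.evalRingHom x)).eval y = 0 ∧ MvPolynomial.eval ![x, y] R ≠ 0) :
    MMCaseDimPiOneFree {w : Fin 2 ⊕ Fin 2 → ℂ |
      (F.map (Polynomial.evalRingHom (w (Sum.inl 0)))).eval (w (Sum.inl 1)) = 0 ∧
      w (Sum.inr 0) = MvPolynomial.eval ![w (Sum.inl 0), w (Sum.inl 1)] R} := by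
  classical
  obtain ⟨Φr, hΦr⟩ := exists_rowsEquiv
  set A : MvPolynomial (Fin 2) ℂ := Φr.symm F with hA
  have hPQ : ∀ x y : ℂ, MvPolynomial.eval ![x, y] A = (F.map (Polynomial.evalRingHom x)).eval y := by
    intro x y
    rw [hΦr, hA, RingEquiv.apply_symm_apply]
  have hirrA : Irreducible A := (irreducible_rows_iff hPQ).2 hFirr
  have hset : {w : Fin 2 ⊕ Fin 2 → ℂ |
      (F.map (Polynomial.evalRingHom (w (Sum.inl 0)))).eval (w (Sum.inl 1)) = 0 ∧
      w (Sum.inr 0) = MvPolynomial.eval ![w (Sum.inl 0), w (Sum.inl 1)] R} =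
      {w : Fin 2 ⊕ Fin 2 → ℂ | MvPolynomial.eval ![w (Sum.inl 0), w (Sum.inl 1)] A = 0 ∧
        w (Sum.inr 0) = MvPolynomial.eval ![w (Sum.inl 0), w (Sum.inl 1)] R} := by
    ext w
    simp only [Set.mem_setOf_eq, hPQ]
  rw [hset]
  refine mmCase_curveGraphFibre hirrA ?_ ?_
  · obtain ⟨x, y, hxy, hne⟩ := hR
    exact ⟨![x, y], by rw [hPQ]; exact hxy, hne⟩
  · intro m hm c₀
    obtain ⟨x, y, hxy, hne⟩ := planeCurve_exists_offLine_of_notLine F hFirr hF1 hnl m hm c₀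
    exact ⟨![x, y], by rw [hPQ]; exact hxy, by simpa using hne⟩

/-- The hypothesis holds trivially in `x₁`-degree `≥ 2`. [folklore] -/
theorem notLine_of_two_le (hn : 2 ≤ F.natDegree) :
    F.natDegree = 1 → 1 ≤ F.leadingCoeff.natDegree ∨ 2 ≤ (F.coeff 0).natDegree :=
  fun h => absurd h (by omega)

end NotLine

end Summit.Schanuel.Schanuel.Theorems
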